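import Literature.Probability.RandomPlanarGeometry.HexSAWBrickWallStripFugacityLevel0
import HarnessLib

/-!
# BBdGDCG 2014 Proposition 6, symmetry clause: `C_{T,n}(y,z) = C_{T,n}(z,y)`, hence `μ_T(y,1) = μ_T(1,y)` (printed weights)

Topic `Literature/Probability/RandomPlanarGeometry` (continues `HexSAWBrickWallStripFugacityLevel0.lean` — the printed
one-level bottom-surface count `HexBW.bottomVisits₀` (row `0`, odd abscissa = dangling vertical bond = Duminil-Copin–Smirnov
level `0`) and `HexBW.stripZ₀ T n y = C_{T,n}(y,1)` over the translation classes `HexBW.stripPairs T n` of the brick-wall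
strip `S_T = ℤ × {0,…,T}`).  Source: N. R. Beaton, M. Bousquet-Mélou, J. de Gier, H. Duminil-Copin, A. J. Guttmann, *The
critical fugacity for surface adsorption of self-avoiding walks on the honeycomb lattice is `1 + √2`*, Comm. Math. Phys.
326 (2014), arXiv:1109.0358v5, §3.2 (p. 10): "`C_{T,k}(y,z) = Σ_{|ω|=k} y^{bc(ω)} z^{tc(ω)}` … `bc(ω)` and `tc(ω)` are
the numbers of contacts of `ω` with the bottom and top of the strip", Proposition 6 (p. 10): "By the symmetry of bridges,
`μ_T(y,z) = μ_T(z,y)`, and so, in particular, `μ_T(y,1) = μ_T(1,y)`", and the sentence after it: "it turns out to be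
convenient to put the interacting monomers on the top, rather than at the bottom" (Proposition 7 is printed for
`μ_T(1,y)`).

## What this file adds

The TOP surface of `S_T` is the set of row-`T` sites whose vertical bond `{(x,T),(x,T+1)}` exists (`x + T` even) and
dangles out of the strip (`adj_up_iff_even`); `topVisits₀ T` counts them, and `stripZ₂ T n y z = C_{T,n}(y,z)` is the
two-fugacity partition function over translation classes.  The map `(x, y) ↦ (x + T + 1, T − y)` is an automorphism
of the brick wall for EVERY `T` (`adj_stripFlip_iff`) preserving `S_T` and exchanging the two surfaces; on translation
classes (re-normalised to the cross-section by an even horizontal shift, `HexBW.snorm`) it is an injection of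
`stripPairs T n` into itself exchanging `bottomVisits₀` and `topVisits₀ T`.  Hence, for the lane's translation-class
model the printed symmetry holds EXACTLY AT EVERY LENGTH:

* **`stripZ₂_symm : stripZ₂ T n y z = stripZ₂ T n z y`** (`C_{T,n}(y,z) = C_{T,n}(z,y)`);
* `stripZ₂_one_right : stripZ₂ T n y 1 = stripZ₀ T n y`, `stripZtop T n z := C_{T,n}(1,z)`,
  **`stripZtop_eq_stripZ₀ : C_{T,n}(1,y) = C_{T,n}(y,1)`** — so every statement of the one-level chain about the
  bottom-weighted `μ_T(y,1) = HexBW.stripMuY₀ T y` (existence, monotonicity, Proposition 7's strict part) IS the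
  statement about the printed top-weighted `μ_T(1,y)`.

(The printed proof is different: there the walks are rooted at a mid-edge below the strip, `C`, `A`, `B` have the same
growth rate, and bridges are symmetric; for translation classes no limit is needed.)  Label (lane «pcv-sawmu»):
CONSOLIDATION of Proposition 6's symmetry clause for the printed weights, by a different (exact, finite-`n`) argument.
-/

noncomputable section

open Finset Literature.Probability.LatticeModels Literature.Probability.Percolation SimpleGraph

namespace Literature.Probability.RandomPlanarGeometry.SAW.HexBW

/-! ### The top surface and the two-fugacity partition function -/

/-- The dangling bond of the TOP boundary: a row-`T` site has the brick-wall bond up to row `T + 1` iff `x + T` is even.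
[cite: EntingJensen2009, §7.4.2, Fig. 7.10 (brickwork form of the honeycomb lattice)] -/
theorem adj_up_iff_even (x : ℤ) (T : ℤ) :
    brickWallGraph.Adj (![x, T] : Site 2) ![x, T + 1] ↔ (x + T) % 2 = 0 := by
  rw [brickWallGraph_adj_coord]
  simp
  omega

/-- The number of TOP-surface vertices (row `T`, vertical bond dangling upwards: `x + T` even) of the placed walk
`m ↦ a + υ m`, `m ≤ n` — the printed `tc(ω)`. [cite: BeatonBousquetMelouDeGierDuminilCopinGuttmann2014, §3.2 (arXiv v5 p. 10: tc(ω) = contacts with the top of the strip)] -/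
def topVisits₀ (T : ℕ) (a : Site 2) (υ : ℕ → Site 2) (n : ℕ) : ℕ :=
  ∑ m ∈ Finset.range (n + 1), if (a + υ m) 1 = (T : ℤ) ∧ ((a + υ m) 0 + T) % 2 = 0 then 1 else 0

/-- **`C_{T,n}(y,z)`** over translation classes: fugacity `y` per bottom-surface vertex, `z` per top-surface vertex.
[cite: BeatonBousquetMelouDeGierDuminilCopinGuttmann2014, §3.2 (arXiv v5 p. 10: C_{T,k}(y,z) = Σ y^{bc(ω)} z^{tc(ω)})] -/
def stripZ₂ (T n : ℕ) (y z : ℝ) : ℝ :=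
  ∑ p ∈ stripPairs T n, y ^ bottomVisits₀ p.1 p.2 n * z ^ topVisits₀ T p.1 p.2 n

/-- **`C_{T,n}(1,z)`**: the TOP-weighted one-level partition function (the weight of the printed Proposition 7).
[cite: BeatonBousquetMelouDeGierDuminilCopinGuttmann2014, Proposition 6 (arXiv v5 p. 10: μ_T(y,1) = μ_T(1,y))] -/
def stripZtop (T n : ℕ) (z : ℝ) : ℝ := ∑ p ∈ stripPairs T n, z ^ topVisits₀ T p.1 p.2 n

/-- `C_{T,n}(y,1) = stripZ₀ T n y`. [cite: BeatonBousquetMelouDeGierDuminilCopinGuttmann2014, §3.2 (arXiv v5 p. 10)] -/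
theorem stripZ₂_one_right (T n : ℕ) (y : ℝ) : stripZ₂ T n y 1 = stripZ₀ T n y := by
  simp [stripZ₂, stripZ₀]

/-- `C_{T,n}(1,z) = stripZtop T n z`. [cite: BeatonBousquetMelouDeGierDuminilCopinGuttmann2014, §3.2 (arXiv v5 p. 10)] -/
theorem stripZ₂_one_left (T n : ℕ) (z : ℝ) : stripZ₂ T n 1 z = stripZtop T n z := by
  simp [stripZ₂, stripZtop]

/-! ### The strip reflection `(x, y) ↦ (x + T + 1, T − y)` -/

/-- The strip reflection exchanging the two surfaces of `S_T`: `(x, y) ↦ (x + T + 1, T − y)` (the horizontal unit is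
added exactly when needed to keep the parity classes of the brick wall). [cite: BeatonBousquetMelouDeGierDuminilCopinGuttmann2014, Proposition 6 (arXiv v5 p. 10: "By the symmetry of bridges, μ_T(y,z) = μ_T(z,y)")] -/
def stripFlip (T : ℕ) (v : Site 2) : Site 2 := ![v 0 + T + 1, (T : ℤ) - v 1]

/-- Coordinates of `stripFlip`. [cite: BeatonBousquetMelouDeGierDuminilCopinGuttmann2014, Proposition 6 (arXiv v5 p. 10)] -/
@[simp] theorem stripFlip_apply_zero (T : ℕ) (v : Site 2) : stripFlip T v 0 = v 0 + T + 1 := rfl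

/-- Coordinates of `stripFlip`. [cite: BeatonBousquetMelouDeGierDuminilCopinGuttmann2014, Proposition 6 (arXiv v5 p. 10)] -/
@[simp] theorem stripFlip_apply_one (T : ℕ) (v : Site 2) : stripFlip T v 1 = (T : ℤ) - v 1 := rfl

/-- `stripFlip T (a + w) = stripFlip T a + negY w` (the linear part is the height reflection `negY`).
[cite: EntingJensen2009, §7.4.2, Fig. 7.10 (brickwork form of the honeycomb lattice)] -/
theorem stripFlip_add (T : ℕ) (a w : Site 2) : stripFlip T (a + w) = stripFlip T a + negY w := by
  funext j
  fin_cases j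
  · simp [stripFlip]; ring
  · simp [stripFlip]; ring

/-- **The strip reflection is an automorphism of the brick wall** (for every `T`). [cite: EntingJensen2009, §7.4.2, Fig. 7.10 (brickwork form of the honeycomb lattice)] -/
theorem adj_stripFlip_iff (T : ℕ) (x y : Site 2) :
    brickWallGraph.Adj (stripFlip T x) (stripFlip T y) ↔ brickWallGraph.Adj x y := by
  simp only [brickWallGraph_adj_coord, stripFlip_apply_zero, stripFlip_apply_one]
  omega

/-- The strip reflection preserves `S_T`. [cite: MadrasSlade1993, §8.2, eq. (8.2.1)] -/
theorem inStrip_stripFlip_iff (T : ℕ) (v : Site 2) : InStrip T (stripFlip T v) ↔ InStrip T v := by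
  simp only [InStrip, stripFlip_apply_one]
  omega

/-- Bottom-surface test of a reflected (and evenly translated) site = top-surface test of the site. [cite: BeatonBousquetMelouDeGierDuminilCopinGuttmann2014, Proposition 6 (arXiv v5 p. 10)] -/
theorem bot_flip_iff (T : ℕ) {t : Site 2} (ht0 : t 0 % 2 = 0) (ht1 : t 1 = 0) (v : Site 2) :
    ((t + stripFlip T v) 1 = 0 ∧ (t + stripFlip T v) 0 % 2 = 1) ↔
      (v 1 = (T : ℤ) ∧ (v 0 + T) % 2 = 0) := by
  simp only [Pi.add_apply, stripFlip_apply_zero, stripFlip_apply_one, ht1, zero_add]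
  omega

/-- Top-surface test of a reflected (and evenly translated) site = bottom-surface test of the site. [cite: BeatonBousquetMelouDeGierDuminilCopinGuttmann2014, Proposition 6 (arXiv v5 p. 10)] -/
theorem top_flip_iff (T : ℕ) {t : Site 2} (ht0 : t 0 % 2 = 0) (ht1 : t 1 = 0) (v : Site 2) :
    ((t + stripFlip T v) 1 = (T : ℤ) ∧ ((t + stripFlip T v) 0 + T) % 2 = 0) ↔
      (v 1 = 0 ∧ v 0 % 2 = 1) := by
  simp only [Pi.add_apply, stripFlip_apply_zero, stripFlip_apply_one, ht1, zero_add]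
  omega

/-- Post-composition with `negY` preserves the `ℤ²` walks from `0`. [cite: MadrasSlade1993, §1.2] -/
theorem negY_comp_mem_zdSaws {n : ℕ} {ω : ℕ → Site 2} (hω : ω ∈ Zd.saws 2 n) :
    (fun i => negY (ω i)) ∈ Zd.saws 2 n := by
  obtain ⟨h0, hend, hadj, hinj⟩ := Zd.mem_saws.1 hω
  refine Zd.mem_saws.2 ⟨by simp [h0], fun i hi => by simp [hend i hi], fun i hi =>
    (zd_adj_negY_iff _ _).2 (hadj i hi), fun i hi j hj hij => hinj hi hj (negY_injective hij)⟩

/-! ### The reflection on translation classes -/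

/-- The reflection on translation classes: reflect the placed walk and translate it back to the cross-section by the
even horizontal vector `snorm b − b`, `b` the reflected start. [cite: BeatonBousquetMelouDeGierDuminilCopinGuttmann2014, Proposition 6 (arXiv v5 p. 10: symmetry of bridges)] -/
def flipPair (T : ℕ) (p : Site 2 × (ℕ → Site 2)) : Site 2 × (ℕ → Site 2) :=
  (snorm (stripFlip T p.1), fun i => negY (p.2 i))

/-- The placed image walk is an even horizontal translate of the reflected placed walk.
[cite: MadrasSlade1993, §8.2, eq. (8.2.1) (translation classes)] -/
theorem flipPair_placed (T : ℕ) (p : Site 2 × (ℕ → Site 2)) (i : ℕ) :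
    (flipPair T p).1 + (flipPair T p).2 i =
      (snorm (stripFlip T p.1) - stripFlip T p.1) + stripFlip T (p.1 + p.2 i) := by
  simp only [flipPair, stripFlip_add]; abel

/-- The translation vector `snorm b − b` is horizontal and even. [cite: MadrasSlade1993, §8.2, eq. (8.2.1)] -/
theorem snorm_sub_even (b : Site 2) : (snorm b - b) 0 % 2 = 0 ∧ (snorm b - b) 1 = 0 := by
  refine ⟨?_, ?_⟩
  · simp only [Pi.sub_apply, snorm_apply_zero]; omega
  · simp only [Pi.sub_apply, snorm_apply_one, sub_self]

/-- **The reflection maps `stripPairs T n` into itself.** [cite: MadrasSlade1993, §8.2, eq. (8.2.1)]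
[cite: BeatonBousquetMelouDeGierDuminilCopinGuttmann2014, Proposition 6 (arXiv v5 p. 10: symmetry of bridges)] -/
theorem flipPair_mem {T n : ℕ} {p : Site 2 × (ℕ → Site 2)} (hp : p ∈ stripPairs T n) :
    flipPair T p ∈ stripPairs T n := by
  obtain ⟨ha, hυ, hbw, hin⟩ := mem_stripPairs.1 hp
  have hflip_in : InStrip T (stripFlip T p.1) := (inStrip_stripFlip_iff T p.1).2 (mem_stripStarts.1 ha).2
  obtain ⟨he0, he1⟩ := snorm_sub_even (stripFlip T p.1)
  have hev : ((snorm (stripFlip T p.1) - stripFlip T p.1) 0 + (snorm (stripFlip T p.1) - stripFlip T p.1) 1) % 2 = 0 := by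
    rw [he1, add_zero]; exact he0
  refine mem_stripPairs.2 ⟨snorm_mem_stripStarts hflip_in, negY_comp_mem_zdSaws hυ, fun i hi => ?_, fun m hm => ?_⟩
  · show brickWallGraph.Adj ((flipPair T p).1 + (flipPair T p).2 i) ((flipPair T p).1 + (flipPair T p).2 (i + 1))
    rw [flipPair_placed, flipPair_placed, adj_add_left_iff_of_even hev, adj_stripFlip_iff]
    exact hbw i hi
  · show InStrip T ((flipPair T p).1 + (flipPair T p).2 m)
    rw [flipPair_placed]
    have h := (inStrip_stripFlip_iff T (p.1 + p.2 m)).2 (hin m hm)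
    refine ⟨?_, ?_⟩
    · have := h.1; simp only [Pi.add_apply, he1, zero_add]; exact this
    · have := h.2; simp only [Pi.add_apply, he1, zero_add]; exact this

/-- **The reflection is injective on `stripPairs T n`.** [cite: MadrasSlade1993, §8.2, eq. (8.2.1)] -/
theorem flipPair_injOn (T n : ℕ) : Set.InjOn (flipPair T) ↑(stripPairs T n) := by
  rintro ⟨a, υ⟩ hp ⟨a', υ'⟩ hp' h
  rw [Finset.mem_coe, mem_stripPairs] at hp hp'
  dsimp only at hp hp'
  have ha := (mem_stripStarts.1 hp.1).1
  have ha' := (mem_stripStarts.1 hp'.1).1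
  simp only [flipPair, Prod.mk.injEq] at h
  obtain ⟨h1, h2⟩ := h
  have h1' : snorm (stripFlip T a) 0 = snorm (stripFlip T a') 0 ∧ snorm (stripFlip T a) 1 = snorm (stripFlip T a') 1 :=
    ⟨congrFun h1 0, congrFun h1 1⟩
  simp only [snorm_apply_zero, snorm_apply_one, stripFlip_apply_zero, stripFlip_apply_one] at h1'
  have hυ : υ = υ' := funext fun i => negY_injective (congrFun h2 i)
  have ha0 : a 0 = a' 0 := by omega
  have ha1 : a 1 = a' 1 := by omega
  have haa : a = a' := by funext j; fin_cases j <;> assumption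
  rw [haa, hυ]

/-- The reflection exchanges the two surface counts: bottom count of the image = top count of the walk.
[cite: BeatonBousquetMelouDeGierDuminilCopinGuttmann2014, Proposition 6 (arXiv v5 p. 10: symmetry of bridges)] -/
theorem bottomVisits₀_flipPair (T n : ℕ) (p : Site 2 × (ℕ → Site 2)) :
    bottomVisits₀ (flipPair T p).1 (flipPair T p).2 n = topVisits₀ T p.1 p.2 n := by
  unfold bottomVisits₀ topVisits₀
  refine Finset.sum_congr rfl fun m _ => ?_
  obtain ⟨he0, he1⟩ := snorm_sub_even (stripFlip T p.1)
  rw [flipPair_placed]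
  by_cases h : (p.1 + p.2 m) 1 = (T : ℤ) ∧ ((p.1 + p.2 m) 0 + T) % 2 = 0
  · rw [if_pos h, if_pos ((bot_flip_iff T he0 he1 _).2 h)]
  · rw [if_neg h, if_neg (fun h' => h ((bot_flip_iff T he0 he1 _).1 h'))]

/-- The reflection exchanges the two surface counts: top count of the image = bottom count of the walk.
[cite: BeatonBousquetMelouDeGierDuminilCopinGuttmann2014, Proposition 6 (arXiv v5 p. 10: symmetry of bridges)] -/
theorem topVisits₀_flipPair (T n : ℕ) (p : Site 2 × (ℕ → Site 2)) :
    topVisits₀ T (flipPair T p).1 (flipPair T p).2 n = bottomVisits₀ p.1 p.2 n := by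
  unfold bottomVisits₀ topVisits₀
  refine Finset.sum_congr rfl fun m _ => ?_
  obtain ⟨he0, he1⟩ := snorm_sub_even (stripFlip T p.1)
  rw [flipPair_placed]
  by_cases h : (p.1 + p.2 m) 1 = 0 ∧ (p.1 + p.2 m) 0 % 2 = 1
  · rw [if_pos h, if_pos ((top_flip_iff T he0 he1 _).2 h)]
  · rw [if_neg h, if_neg (fun h' => h ((top_flip_iff T he0 he1 _).1 h'))]

/-! ### The symmetry -/

/-- **Proposition 6, symmetry clause, for the printed weights, exactly at every length**: `C_{T,n}(y,z) = C_{T,n}(z,y)`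
over translation classes. [cite: BeatonBousquetMelouDeGierDuminilCopinGuttmann2014, Proposition 6 (arXiv v5 p. 10: "By the symmetry of bridges, μ_T(y,z) = μ_T(z,y)")] -/
theorem stripZ₂_symm (T n : ℕ) (y z : ℝ) : stripZ₂ T n y z = stripZ₂ T n z y := by
  classical
  -- the reflection is a bijection of `stripPairs T n` onto itself
  have himg : (stripPairs T n).image (flipPair T) = stripPairs T n := by
    refine Finset.eq_of_subset_of_card_le (fun q hq => ?_) ?_
    · obtain ⟨p, hp, rfl⟩ := Finset.mem_image.1 hq
      exact flipPair_mem hp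
    · rw [Finset.card_image_of_injOn (flipPair_injOn T n)]
  calc stripZ₂ T n y z
      = ∑ p ∈ stripPairs T n, z ^ bottomVisits₀ (flipPair T p).1 (flipPair T p).2 n *
          y ^ topVisits₀ T (flipPair T p).1 (flipPair T p).2 n := by
        unfold stripZ₂
        refine Finset.sum_congr rfl fun p _ => ?_
        rw [bottomVisits₀_flipPair, topVisits₀_flipPair, mul_comm]
    _ = ∑ q ∈ (stripPairs T n).image (flipPair T), z ^ bottomVisits₀ q.1 q.2 n * y ^ topVisits₀ T q.1 q.2 n := by
        rw [Finset.sum_image (flipPair_injOn T n)]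
    _ = stripZ₂ T n z y := by rw [himg, stripZ₂]

/-- **`C_{T,n}(1,y) = C_{T,n}(y,1)`**: the top-weighted and the bottom-weighted one-level partition functions coincide
at every length — "in particular, `μ_T(y,1) = μ_T(1,y)`", so every statement about `HexBW.stripMuY₀` is the statement
about the printed top-weighted `μ_T(1,y)` of Proposition 7. [cite: BeatonBousquetMelouDeGierDuminilCopinGuttmann2014, Proposition 6 (arXiv v5 p. 10: "and so, in particular, μ_T(y,1) = μ_T(1,y)")] -/
theorem stripZtop_eq_stripZ₀ (T n : ℕ) (y : ℝ) : stripZtop T n y = stripZ₀ T n y := by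
  rw [← stripZ₂_one_left, stripZ₂_symm, stripZ₂_one_right]

end Literature.Probability.RandomPlanarGeometry.SAW.HexBW
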